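import Mathlib.RingTheory.Polynomial.RationalRoot
import Mathlib.RingTheory.UniqueFactorizationDomain.Multiplicity
import Mathlib.Algebra.Polynomial.Degree.SmallDegree
import HarnessLib

/-!
# (INT)_K, the `3`-adic descent step: a cube system in a UFD forces bounded `3`-power denominators
(route `ManinLocalTwoThree`, crux C3 `ManinPrimeToThreeAtNine` stmt-BirchSwinnertonDyer-22968; cell bsd-f2-manin, prover seat p3 gen 16 —
piece (INT)_K of -an g39's `K`-rational UDC line, p2 g18's interface; `--supports` 22968)

Pure UFD algebra, to be applied in `ℤ₃⟦q⟧` (where `4` is a unit) to the components `U, V` of the renormalised cube root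
`g = U + Y·V` (`Y² = r = 3ᵗ·r₀`): if `A·U = B_u`, `A·V = B_v` are "integral" and the cube system
`3ᵉ(B_u³ + 3r B_u B_v²) = A³T₁`, `3ᵉ(3B_u²B_v + r B_v³) = A³T₂` holds (i.e. `(U + Y V)³ = (T₁ + Y T₂)/(3ᵉ A³)·A³`), then
`A ∣ 3^{e+t} B_u` and `A ∣ 3^{e+t} B_v` — the denominators of `U, V` are bounded powers of `3`.
Mechanism: the norm `N = B_u² − r B_v²` has `(3ᵉN)³ = (A²)³·3ᵉ(T₁² − rT₂²)` so `A² ∣ 3ᵉN` (`pow_dvd_pow_iff_dvd`); then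
`4(3ᵉB_u)³ − 3^{e+1}N₁A²(3ᵉB_u) − 3^{2e}T₁A³ = 0` makes `3ᵉB_u/A` a root of a monic cubic, hence integral (integral root theorem
in a UFD); finally `(3^{e+t}B_v)² ∈ A²·R`.

* `dvd_of_cube_system` — the statement above, for any `UniqueFactorizationMonoid` domain in which `4` is a unit.

HONEST FRAMING.  Pure commutative algebra; nothing about (INT)_K's conclusion, C3, Manin's conjecture or BSD is proved here.
No definitions, no sorry. [folklore]
-/

set_option autoImplicit false
-- lint-debt: the directory name repeats the summit name (sibling precedent `ManinLocalTwoThreeAlgIntCubeRoot.lean`)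
set_option linter.dupNamespace false

noncomputable section

open scoped Classical
open Polynomial

namespace Summit.BirchSwinnertonDyer.BirchSwinnertonDyer.Theorems.ManinLocalTwoThree.CubeSystemDescent

variable {R : Type*} [CommRing R] [IsDomain R] [UniqueFactorizationMonoid R]

/-- **Integral root theorem, divisibility form**: if `4W³ = A²(c₀A + c₁W)` in a UFD where `4` is a unit and `A ≠ 0`, then `A ∣ W`
(`W/A` is a root of the monic cubic `X³ − ¼c₁X − ¼c₀`). [folklore] -/
theorem dvd_of_cubic (h4 : IsUnit (4 : R)) {A W c₀ c₁ : R} (hA : A ≠ 0) (h : 4 * W ^ 3 = A ^ 2 * (c₀ * A + c₁ * W)) : A ∣ W := by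
  obtain ⟨i4, hi4⟩ : ∃ i : R, 4 * i = 1 := ⟨↑h4.unit⁻¹, h4.mul_val_inv⟩
  have hAK : (algebraMap R (FractionRing R) A) ≠ 0 := fun h0 ↦ hA (IsFractionRing.injective R (FractionRing R) (by rw [h0, map_zero]))
  have key := congrArg (algebraMap R (FractionRing R)) h
  have key4 := congrArg (algebraMap R (FractionRing R)) hi4
  simp only [map_mul, map_pow, map_add, map_one, map_ofNat] at key key4
  set w : FractionRing R := algebraMap R (FractionRing R) W with hw
  set a : FractionRing R := algebraMap R (FractionRing R) A with ha
  set p : R[X] := X ^ 3 - (Polynomial.C (i4 * c₁) * X + Polynomial.C (i4 * c₀)) with hp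
  have hpm : p.Monic := by
    rw [hp]
    refine (monic_X_pow 3).sub_of_left (lt_of_le_of_lt degree_linear_le ?_)
    rw [degree_X_pow]; norm_num
  have hroot : aeval (w / a) p = 0 := by
    have e1 : aeval (w / a) p = (w / a) ^ 3 - (algebraMap R (FractionRing R) (i4 * c₁) * (w / a)
        + algebraMap R (FractionRing R) (i4 * c₀)) := by
      rw [hp]; simp only [map_sub, map_add, map_mul, map_pow, aeval_X, aeval_C]
    have e3 : w / a * a ^ 3 = w * a ^ 2 := by
      rw [show a ^ 3 = a * a ^ 2 by ring, ← mul_assoc, div_mul_cancel₀ w hAK]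
    have e2 : (algebraMap R (FractionRing R) (i4 * c₁) * (w / a) + algebraMap R (FractionRing R) (i4 * c₀)) * a ^ 3 =
        algebraMap R (FractionRing R) i4 * algebraMap R (FractionRing R) c₁ * w * a ^ 2
          + algebraMap R (FractionRing R) i4 * algebraMap R (FractionRing R) c₀ * a ^ 3 := by
      rw [map_mul, map_mul, add_mul, mul_assoc _ (w / a), e3]; ring
    rw [e1, div_pow, sub_eq_zero, div_eq_iff (pow_ne_zero 3 hAK), e2]
    linear_combination (algebraMap R (FractionRing R) i4) * key - (w ^ 3) * key4
  obtain ⟨y, hy⟩ := isInteger_of_is_root_of_monic hpm hroot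
  refine ⟨y, IsFractionRing.injective R (FractionRing R) ?_⟩
  rw [map_mul, hy, ← hw, ← ha, mul_comm]
  exact (div_mul_cancel₀ w hAK).symm

/-- **The descent.**  In a UFD with `4` a unit: from `3ᵉ(B_u³ + 3rB_uB_v²) = A³T₁`, `3ᵉ(3B_u²B_v + rB_v³) = A³T₂` with `r = 3ᵗr₀`,
`r₀` a unit and `A ≠ 0`, conclude `A ∣ 3^{e+t}B_u` and `A ∣ 3^{e+t}B_v`. [folklore] -/
theorem dvd_of_cube_system (h4 : IsUnit (4 : R)) {A Bu Bv T₁ T₂ r₀ : R} (hr₀ : IsUnit r₀) {e t : ℕ} (hA : A ≠ 0)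
    (E1 : 3 ^ e * (Bu ^ 3 + 3 * (3 ^ t * r₀) * Bu * Bv ^ 2) = A ^ 3 * T₁)
    (E2 : 3 ^ e * (3 * Bu ^ 2 * Bv + (3 ^ t * r₀) * Bv ^ 3) = A ^ 3 * T₂) :
    A ∣ 3 ^ (e + t) * Bu ∧ A ∣ 3 ^ (e + t) * Bv := by
  -- the norm `N = Bu² − r Bv²`: `(3ᵉN)³ = (A²)³ · 3ᵉ(T₁² − rT₂²)`
  have hN3 : (A ^ 2) ^ 3 ∣ (3 ^ e * (Bu ^ 2 - 3 ^ t * r₀ * Bv ^ 2)) ^ 3 := by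
    refine ⟨3 ^ e * (T₁ ^ 2 - 3 ^ t * r₀ * T₂ ^ 2), ?_⟩
    linear_combination (3 ^ e * (3 ^ e * (Bu ^ 3 + 3 * (3 ^ t * r₀) * Bu * Bv ^ 2) + A ^ 3 * T₁)) * E1
      - (3 ^ e * (3 ^ t * r₀) * (3 ^ e * (3 * Bu ^ 2 * Bv + (3 ^ t * r₀) * Bv ^ 3) + A ^ 3 * T₂)) * E2
  obtain ⟨N₁, hN₁⟩ : A ^ 2 ∣ 3 ^ e * (Bu ^ 2 - 3 ^ t * r₀ * Bv ^ 2) :=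
    (UniqueFactorizationMonoid.pow_dvd_pow_iff_dvd (by norm_num : (3 : ℕ) ≠ 0)).mp hN3
  -- the cubic for `W = 3ᵉ Bu`
  have hcub : 4 * (3 ^ e * Bu) ^ 3 = A ^ 2 * ((3 ^ e) ^ 2 * T₁ * A + 3 * 3 ^ e * N₁ * (3 ^ e * Bu)) := by
    linear_combination (3 ^ e) ^ 2 * E1 + ((3 ^ e) ^ 2 * 3 * Bu) * hN₁
  obtain ⟨y, hy⟩ := dvd_of_cubic h4 hA hcub
  -- `Bv`: `(3^{e+t}Bv)² = 3ᵗ r₀⁻¹ A² (y² − 3ᵉN₁)`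
  obtain ⟨j, hj⟩ : ∃ j : R, r₀ * j = 1 := ⟨↑hr₀.unit⁻¹, hr₀.mul_val_inv⟩
  have hV2 : A ^ 2 ∣ (3 ^ (e + t) * Bv) ^ 2 := by
    refine ⟨3 ^ t * j * (y ^ 2 - 3 ^ e * N₁), ?_⟩
    rw [pow_add]
    linear_combination (3 ^ t * j * (A * y + 3 ^ e * Bu)) * hy - (3 ^ t * j * 3 ^ e) * hN₁ - ((3 ^ e * 3 ^ t * Bv) ^ 2) * hj
  have hV : A ∣ 3 ^ (e + t) * Bv := (UniqueFactorizationMonoid.pow_dvd_pow_iff_dvd (by norm_num : (2 : ℕ) ≠ 0)).mp hV2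
  refine ⟨?_, hV⟩
  rw [pow_add, mul_comm (3 ^ e), mul_assoc, hy]
  exact Dvd.intro (3 ^ t * y) (by ring)

end Summit.BirchSwinnertonDyer.BirchSwinnertonDyer.Theorems.ManinLocalTwoThree.CubeSystemDescent

end
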